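import Literature.Probability.LatticeModels.DobrushinShlosmanUniqueness
import Literature.Probability.LatticeModels.DobrushinShlosmanStates
import HarnessLib

/-!
# The Dobrushin–Shlosman window comparison in INFINITE volume: two functionals, and the covariance
# decay of every Gibbs measure

Topic `Literature/Probability/LatticeModels`; theorems only (no definitions, no named facts). Continues
`DobrushinShlosmanUniqueness.lean` (boundary insensitivity of the kernels, uniqueness).

* `abs_sub_le_of_window` — the comparison `|E₁ F − E₂ F| ≤ 2 R e^{−κ₁ L₀} Σ_{x ∈ Λ} δ x` for two
  functionals monotone-normalised on the bounded measurable `Λ`-local observables and invariant under the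
  window kernels of the usable centres (Dobrushin–Shlosman 1985, Theorem, Vasserstein form, run on the
  finite cell type `↥Λ` with frozen non-interior centres — the same device as
  `abs_integral_sub_integral_le_of_window`, with the two kernels replaced by abstract functionals and an
  extra usability predicate `P`).
* `abs_covariance_le_of_window` — **covariance decay for every Gibbs measure of a specification on an
  arbitrary index set** under the window condition (Föllmer 1988 Ch. I Thm. (2.13) / Künsch 1982 /
  Georgii 2011 §8.2, tilt trick: `E₁ = μ`, `E₂ = μ` tilted by `g − g(τ₀) + R Σ δ_g ≥ 0`, usable = windows
  avoiding the support of `g`): `|cov_μ(f, g)| ≤ 4 R² e^{−κ₁ L₀} (Σ δ_f)(Σ δ_g)`,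
  `κ₁ = (1−γ₀)²/(2(2γ₀N⋆+1))`, for every finite `Λ` carrying the supports and an adapted profile
  `≥ L₀` on the support of `f`.

References: R. L. Dobrushin, S. B. Shlosman (1985), Thm. 1, §2; H. Föllmer, LNM 1362 (1988) Ch. I Thm.
(2.13); H. Künsch, CMP 84 (1982); H.-O. Georgii (2011) §8.2; tree files `DobrushinShlosmanContraction.lean`,
`DobrushinShlosmanStates.lean`, `DobrushinShlosmanUniqueness.lean`.
-/

noncomputable section

open MeasureTheory ProbabilityTheory Finset Function
open Literature.Probability.LatticeModels.DobrushinMetric (IsLipBound integrable_of_abs_le'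
  abs_sub_le_mul_sum_of_dependsOn)

namespace Literature.Probability.LatticeModels.DobrushinShlosman

variable {V S : Type*} [MeasurableSpace S]

/-- Freezing one coordinate to a constant is measurable. [folklore] -/
private theorem measurable_update_const'' [DecidableEq V] (y : V) (a : S) :
    Measurable fun σ : V → S => Function.update σ y a := by
  refine measurable_pi_iff.2 fun z => ?_
  by_cases hz : z = y
  · subst hz
    simp only [Function.update_self]
    exact measurable_const
  · simp only [Function.update_of_ne hz]
    exact measurable_pi_apply z

/-! ### The comparison for two functionals -/

/-- **The Dobrushin–Shlosman window comparison for two functionals in infinite volume** (the engine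
behind boundary insensitivity AND covariance decay; Dobrushin–Shlosman 1985, Theorem, Vasserstein form;
Föllmer 1988 Ch. I (2.7)–(2.10), Thm. (2.13)). Window data as in `abs_integral_sub_integral_le_of_window`
(specification `γ` on an arbitrary index set `V`, site weight `0 ≤ r ≤ R`, windows `win c ∋ c` with locality
sets `nbhd c`, array `K ≥ 0` supported in `nbhd c`, (H1) `hcontract`, locality `hloc`, per-window received
sum `≤ γ₀ < 1`, `≤ N⋆` windows per site). Let `Λ` be a finite volume, `E₁, E₂` two functionals that are
monotone-normalised on bounded measurable `Λ`-local observables and invariant under the window kernels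
`γ_{win c}` of the USABLE centres `c ∈ Λ` (`nbhd c ⊆ Λ` and `P c`), and `ℓ` a profile such that every window
around a site of positive profile is usable and `ℓ` drops by at most one along the support of `K`. Then for a
bounded measurable `Λ`-local `F` whose site-Lipschitz vector `δ` vanishes where `ℓ < L₀`:
`|E₁ F − E₂ F| ≤ 2 R e^{−(1−γ₀)² L₀/(2(2γ₀N⋆+1))} Σ_{x ∈ Λ} δ x`. PROOF: the tree's finite-cell theorem
`abs_sub_le_exp` on the cell type `↥Λ`; a centre with `nbhd c ⊆ Λ` acts by its window kernel with the
exterior frozen to `ω` (equal to the kernel itself on `Λ`-local observables, by locality), any other centre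
freezes its own site (window `{c}`, array `0`, never usable). [cite: DobrushinShlosman1985, Theorem 1] -/
theorem abs_sub_le_of_window [DecidableEq V] {γ : Specification V S} (hγ : IsSpecification γ)
    {r : S → S → ℝ} {R : ℝ} (hr0 : ∀ a b, 0 ≤ r a b) (hrR : ∀ a b, r a b ≤ R) (hR : 0 ≤ R)
    {win nbhd : V → Finset V} {K : V → V → V → ℝ} (hK0 : ∀ c y x, 0 ≤ K c y x)
    (hself : ∀ c, c ∈ win c) (hwin : ∀ c, win c ⊆ nbhd c)
    (hKsupp : ∀ c y x, K c y x ≠ 0 → y ∈ nbhd c)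
    (hcontract : ∀ (c y : V), y ∉ win c → ∀ (ω η : V → S), (∀ v, v ≠ y → ω v = η v) →
      ∀ (f : (V → S) → ℝ) (δ : V → ℝ), Measurable f → (∃ B, ∀ σ, |f σ| ≤ B) →
        DependsOn f (win c : Set V) → (∀ x, 0 ≤ δ x) →
        (∀ (x : V) (σ τ : V → S), (∀ v, v ≠ x → σ v = τ v) → |f σ - f τ| ≤ δ x * r (σ x) (τ x)) →
          |∫ σ, f σ ∂(γ (win c) ω) - ∫ σ, f σ ∂(γ (win c) η)| ≤
            (∑ x ∈ win c, K c y x * δ x) * r (ω y) (η y))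
    (hloc : ∀ (c : V) (ζ ζ' : V → S), (∀ v ∈ nbhd c, ζ v = ζ' v) →
      ∀ (f : (V → S) → ℝ), Measurable f → (∃ B, ∀ σ, |f σ| ≤ B) → DependsOn f (win c : Set V) →
        ∫ σ, f σ ∂(γ (win c) ζ) = ∫ σ, f σ ∂(γ (win c) ζ'))
    {γ₀ : ℝ} (hγ₀ : 0 ≤ γ₀) (hγ₁ : γ₀ < 1)
    (hsum : ∀ c, ∀ x ∈ win c, ∑ y ∈ nbhd c, K c y x ≤ γ₀)
    {Nstar : ℕ} (hN : ∀ (x : V) (G : Finset V), (G.filter fun c => x ∈ win c).card ≤ Nstar)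
    (Λ : Finset V) (ω : V → S) (P : V → Prop) {E₁ E₂ : ((V → S) → ℝ) → ℝ}
    (h₁le : ∀ ⦃G : (V → S) → ℝ⦄ ⦃M : ℝ⦄, Measurable G → (∃ B, ∀ σ, |G σ| ≤ B) →
      DependsOn G (Λ : Set V) → (∀ σ, G σ ≤ M) → E₁ G ≤ M)
    (h₁ge : ∀ ⦃G : (V → S) → ℝ⦄ ⦃M : ℝ⦄, Measurable G → (∃ B, ∀ σ, |G σ| ≤ B) →
      DependsOn G (Λ : Set V) → (∀ σ, M ≤ G σ) → M ≤ E₁ G)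
    (h₁T : ∀ c, c ∈ Λ → nbhd c ⊆ Λ → P c → ∀ ⦃G : (V → S) → ℝ⦄, Measurable G →
      (∃ B, ∀ σ, |G σ| ≤ B) → DependsOn G (Λ : Set V) →
        E₁ (fun σ => ∫ τ, G τ ∂(γ (win c) σ)) = E₁ G)
    (h₂le : ∀ ⦃G : (V → S) → ℝ⦄ ⦃M : ℝ⦄, Measurable G → (∃ B, ∀ σ, |G σ| ≤ B) →
      DependsOn G (Λ : Set V) → (∀ σ, G σ ≤ M) → E₂ G ≤ M)
    (h₂ge : ∀ ⦃G : (V → S) → ℝ⦄ ⦃M : ℝ⦄, Measurable G → (∃ B, ∀ σ, |G σ| ≤ B) →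
      DependsOn G (Λ : Set V) → (∀ σ, M ≤ G σ) → M ≤ E₂ G)
    (h₂T : ∀ c, c ∈ Λ → nbhd c ⊆ Λ → P c → ∀ ⦃G : (V → S) → ℝ⦄, Measurable G →
      (∃ B, ∀ σ, |G σ| ≤ B) → DependsOn G (Λ : Set V) →
        E₂ (fun σ => ∫ τ, G τ ∂(γ (win c) σ)) = E₂ G)
    (ℓ : V → ℕ) (L₀ : ℕ)
    (hU : ∀ x, ℓ x ≠ 0 → ∀ c, x ∈ win c → c ∈ Λ ∧ nbhd c ⊆ Λ ∧ P c)
    (hℓ : ∀ c x y, x ∈ win c → K c y x ≠ 0 → ℓ x ≤ ℓ y + 1)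
    {F : (V → S) → ℝ} (hFm : Measurable F) {B : ℝ} (hB : ∀ σ, |F σ| ≤ B)
    (hFdep : DependsOn F (Λ : Set V)) {δ : V → ℝ} (hδ : IsLipBound r F δ)
    (hδL : ∀ x, ℓ x < L₀ → δ x = 0) :
    |E₁ F - E₂ F| ≤
      2 * R * Real.exp (-((1 - γ₀) ^ 2 / (2 * (2 * γ₀ * Nstar + 1)) * L₀)) * ∑ x ∈ Λ, δ x := by
  classical
  -- extension of a vector on the cell type `↥Λ` by zero
  let ext : (↥Λ → ℝ) → V → ℝ := fun δ' v => if h : v ∈ Λ then δ' ⟨v, h⟩ else 0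
  have ext_apply : ∀ (δ' : ↥Λ → ℝ) (x : ↥Λ), ext δ' x.1 = δ' x := fun δ' x => by
    simp only [ext, dif_pos x.2]
  have ext_of_not_mem : ∀ (δ' : ↥Λ → ℝ) {v : V}, v ∉ Λ → ext δ' v = 0 := fun δ' v hv => by
    simp only [ext, dif_neg hv]
  -- admissible observables, Lipschitz vectors, window operators on `↥Λ`
  set Adm : ((V → S) → ℝ) → Prop := fun G =>
    Measurable G ∧ (∃ B, ∀ σ, |G σ| ≤ B) ∧ DependsOn G (Λ : Set V) with hAdm
  set Lip : ((V → S) → ℝ) → (↥Λ → ℝ) → Prop := fun G δ' => (∀ x, 0 ≤ δ' x) ∧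
    ∀ (x : ↥Λ) (σ τ : V → S), (∀ v, v ≠ x.1 → σ v = τ v) → |G σ - G τ| ≤ δ' x * r (σ x.1) (τ x.1)
    with hLip
  -- a Lipschitz vector on `↥Λ` of a `Λ`-local observable is a site-Lipschitz bound on `V`
  have lipV : ∀ {G : (V → S) → ℝ} {δ' : ↥Λ → ℝ}, Adm G → Lip G δ' → IsLipBound r G (ext δ') := by
    rintro G δ' ⟨-, -, hGdep⟩ ⟨hδ'0, hδ'⟩
    refine ⟨fun v => ?_, fun v σ τ hστ => ?_⟩
    · by_cases hv : v ∈ Λ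
      · rw [show ext δ' v = δ' ⟨v, hv⟩ from ext_apply δ' ⟨v, hv⟩]; exact hδ'0 _
      · rw [ext_of_not_mem δ' hv]
    · by_cases hv : v ∈ Λ
      · rw [show ext δ' v = δ' ⟨v, hv⟩ from ext_apply δ' ⟨v, hv⟩]
        exact hδ' ⟨v, hv⟩ σ τ hστ
      · rw [ext_of_not_mem δ' hv, zero_mul]
        rw [hGdep fun u hu => hστ u fun huv => hv (huv ▸ Finset.mem_coe.1 hu), sub_self, abs_zero]
  set T : ↥Λ → ((V → S) → ℝ) → ((V → S) → ℝ) := fun c G =>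
    if nbhd c.1 ⊆ Λ then fun σ => ∫ τ, G τ ∂(γ (win c.1) (Λ.piecewise σ ω))
    else fun σ => G (Function.update σ c.1 (ω c.1)) with hT
  set win' : ↥Λ → Finset ↥Λ := fun c =>
    if nbhd c.1 ⊆ Λ then (win c.1).subtype (· ∈ Λ) else {c} with hwin'
  set k' : ↥Λ → ↥Λ → ↥Λ → ℝ := fun c y x => if nbhd c.1 ⊆ Λ then K c.1 y.1 x.1 else 0 with hk'
  set U : Finset ↥Λ := Finset.univ.filter fun c => nbhd c.1 ⊆ Λ ∧ P c.1 with hUdef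
  -- membership in the two kinds of windows
  have mem_win'_gen : ∀ {c x : ↥Λ}, nbhd c.1 ⊆ Λ → (x ∈ win' c ↔ x.1 ∈ win c.1) :=
    fun {c x} hc => by simp only [hwin', if_pos hc, Finset.mem_subtype]
  have mem_win'_frz : ∀ {c x : ↥Λ}, ¬ nbhd c.1 ⊆ Λ → (x ∈ win' c ↔ x = c) :=
    fun {c x} hc => by simp only [hwin', if_neg hc, Finset.mem_singleton]
  have mem_win_of_mem_win' : ∀ {c x : ↥Λ}, x ∈ win' c → x.1 ∈ win c.1 := fun {c x} hx => by
    by_cases hc : nbhd c.1 ⊆ Λ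
    · exact (mem_win'_gen hc).1 hx
    · rw [(mem_win'_frz hc).1 hx]; exact hself _
  -- (hlip0)
  have hlip0 : ∀ ⦃G : (V → S) → ℝ⦄ ⦃δ' : ↥Λ → ℝ⦄, Lip G δ' → ∀ x, 0 ≤ δ' x := fun G δ' h => h.1
  -- (hosc) interpolation on the sites of `Λ`
  have hoscA : ∀ ⦃G : (V → S) → ℝ⦄ ⦃δ' : ↥Λ → ℝ⦄, Adm G → Lip G δ' →
      ∀ σ τ, |G σ - G τ| ≤ R * ∑ x, δ' x := by
    intro G δ' hG hδ' σ τ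
    have h := abs_sub_le_mul_sum_of_dependsOn hrR hG.2.2 (lipV hG hδ') σ τ
    have hs : ∑ y ∈ Λ, ext δ' y = ∑ x : ↥Λ, δ' x := by
      rw [← Finset.sum_coe_sort]
      exact Finset.sum_congr rfl fun x _ => ext_apply δ' x
    rwa [hs] at h
  -- (hk)
  have hk : ∀ c y x, 0 ≤ k' c y x := fun c y x => by
    simp only [hk']; split_ifs; exacts [hK0 _ _ _, le_rfl]
  -- (hT) the window operators preserve admissibility
  have hTA : ∀ ⦃G : (V → S) → ℝ⦄ (c : ↥Λ), Adm G → Adm (T c G) := by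
    rintro G c ⟨hGm, ⟨B', hB'⟩, hGdep⟩
    by_cases hc : nbhd c.1 ⊆ Λ
    · simp only [hT, if_pos hc]
      refine ⟨(measurable_windowAvg' hγ (win c.1) hGm).comp (measurable_piecewise_conf Λ ω),
        ⟨B', fun σ => abs_windowAvg_le' hγ (win c.1) hB' _⟩, fun σ σ' hσ => ?_⟩
      have : Λ.piecewise σ ω = Λ.piecewise σ' ω := by
        funext v
        by_cases hv : v ∈ Λ
        · rw [Finset.piecewise_eq_of_mem _ _ _ hv, Finset.piecewise_eq_of_mem _ _ _ hv]
          exact hσ v (Finset.mem_coe.2 hv)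
        · rw [Finset.piecewise_eq_of_notMem _ _ _ hv, Finset.piecewise_eq_of_notMem _ _ _ hv]
      simp only [this]
    · simp only [hT, if_neg hc]
      refine ⟨hGm.comp (measurable_update_const'' c.1 (ω c.1)), ⟨B', fun σ => hB' _⟩,
        fun σ σ' hσ => hGdep fun v hv => ?_⟩
      by_cases hvc : v = c.1
      · subst hvc; simp
      · rw [Function.update_of_ne hvc, Function.update_of_ne hvc]; exact hσ v hv
  -- (hdust) the window dusting estimate
  have hdust : ∀ ⦃G : (V → S) → ℝ⦄ ⦃δ' : ↥Λ → ℝ⦄ (c : ↥Λ), Adm G → Lip G δ' →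
      Lip (T c G) fun y => if y ∈ win' c then 0 else δ' y + ∑ x ∈ win' c, k' c y x * δ' x := by
    intro G δ' c hG hδ'
    have hGV := lipV hG hδ'
    obtain ⟨hGm, ⟨B', hB'⟩, hGdep⟩ := hG
    refine ⟨fun y => ?_, fun y σ τ hστ => ?_⟩
    · dsimp only
      split_ifs
      · exact le_rfl
      · exact add_nonneg (hδ'.1 y) (Finset.sum_nonneg fun x _ => mul_nonneg (hk c y x) (hδ'.1 x))
    by_cases hc : nbhd c.1 ⊆ Λ
    · -- a genuine window: the tree's window dusting estimate with the exterior frozen to `ω`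
      have hwinΛ : win c.1 ⊆ Λ := (hwin c.1).trans hc
      have hωη : ∀ v, id v ≠ y.1 → Λ.piecewise σ ω v = Λ.piecewise τ ω v := fun v hv => by
        by_cases hvΛ : v ∈ Λ
        · rw [Finset.piecewise_eq_of_mem _ _ _ hvΛ, Finset.piecewise_eq_of_mem _ _ _ hvΛ]
          exact hστ v hv
        · rw [Finset.piecewise_eq_of_notMem _ _ _ hvΛ, Finset.piecewise_eq_of_notMem _ _ _ hvΛ]
      have key := lip_windowAvg (ι := V) (cell := id) (w := fun x σ τ => r (σ x) (τ x)) hγ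
        (fun x σ σ' τ τ' hσ hτ => by simp only [hσ x rfl, hτ x rfl])
        (Λ := win c.1) (W := win c.1) (fun v => Iff.rfl) (kc := K c.1) (hcontract c.1) hGm hB'
        hGV.nonneg hGV.le y.1 (Λ.piecewise σ ω) (Λ.piecewise τ ω) hωη
      have hry : r (Λ.piecewise σ ω y.1) (Λ.piecewise τ ω y.1) = r (σ y.1) (τ y.1) := by
        rw [Finset.piecewise_eq_of_mem _ _ _ y.2, Finset.piecewise_eq_of_mem _ _ _ y.2]
      have hsumeq : ∑ x ∈ win c.1, K c.1 y.1 x * ext δ' x = ∑ x ∈ win' c, k' c y x * δ' x := by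
        simp only [hwin', hk', if_pos hc]
        rw [← Finset.sum_subtype_of_mem (f := fun x => K c.1 y.1 x * ext δ' x) fun x hx => hwinΛ hx]
        exact Finset.sum_congr rfl fun x _ => by rw [ext_apply]
      have hmem : (y.1 ∈ win c.1) ↔ (y ∈ win' c) := (mem_win'_gen hc).symm
      simp only [hT, if_pos hc]
      rw [hry, hsumeq, ext_apply] at key
      simp only [hmem] at key
      exact key
    · -- a frozen centre: the operator freezes the site `c`, its window is `{c}`, its array is `0`
      simp only [hT, if_neg hc]
      by_cases hyc : y = c
      · subst hyc
        have : Function.update σ y.1 (ω y.1) = Function.update τ y.1 (ω y.1) := by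
          funext v
          by_cases hv : v = y.1
          · subst hv; simp
          · rw [Function.update_of_ne hv, Function.update_of_ne hv]; exact hστ v hv
        rw [this, sub_self, abs_zero]
        exact mul_nonneg (by
          split_ifs
          · exact le_rfl
          · exact add_nonneg (hδ'.1 y)
              (Finset.sum_nonneg fun x _ => mul_nonneg (hk y y x) (hδ'.1 x))) (hr0 _ _)
      · have hy1 : y.1 ≠ c.1 := fun h => hyc (Subtype.ext h)
        have h := hδ'.2 y (Function.update σ c.1 (ω c.1)) (Function.update τ c.1 (ω c.1))
          fun v hv => by
            by_cases hvc : v = c.1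
            · subst hvc; simp
            · rw [Function.update_of_ne hvc, Function.update_of_ne hvc]; exact hστ v hv
        rw [Function.update_of_ne hy1, Function.update_of_ne hy1] at h
        refine h.trans (mul_le_mul_of_nonneg_right ?_ (hr0 _ _))
        rw [if_neg (fun h' => hyc ((mem_win'_frz hc).1 h'))]
        simp only [hk', if_neg hc, zero_mul, Finset.sum_const_zero, add_zero, le_refl]
  -- a genuine window operator IS the window kernel on admissible observables (locality)
  have hTgen : ∀ ⦃G : (V → S) → ℝ⦄ (c : ↥Λ), nbhd c.1 ⊆ Λ → Adm G →
      ∀ σ, T c G σ = ∫ τ, G τ ∂(γ (win c.1) σ) := by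
    rintro G c hc ⟨hGm, ⟨B', hB'⟩, hGdep⟩ σ
    simp only [hT, if_pos hc]
    exact windowAvg_congr_of_local hγ hc (hloc c.1) hGm hB' hGdep fun v hv =>
      Finset.piecewise_eq_of_mem _ _ _ hv
  -- hence both functionals are invariant under the usable window operators
  have hTfun : ∀ ⦃G : (V → S) → ℝ⦄ (c : ↥Λ), nbhd c.1 ⊆ Λ → Adm G →
      T c G = fun σ => ∫ τ, G τ ∂(γ (win c.1) σ) := fun G c hc hG => funext (hTgen c hc hG)
  have hinv₁ : ∀ ⦃G : (V → S) → ℝ⦄ (c : ↥Λ), c ∈ U → Adm G → E₁ (T c G) = E₁ G := by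
    intro G c hc hG
    obtain ⟨hc₁, hc₂⟩ := (Finset.mem_filter.1 hc).2
    rw [hTfun c hc₁ hG]
    exact h₁T c.1 c.2 hc₁ hc₂ hG.1 hG.2.1 hG.2.2
  have hinv₂ : ∀ ⦃G : (V → S) → ℝ⦄ (c : ↥Λ), c ∈ U → Adm G → E₂ (T c G) = E₂ G := by
    intro G c hc hG
    obtain ⟨hc₁, hc₂⟩ := (Finset.mem_filter.1 hc).2
    rw [hTfun c hc₁ hG]
    exact h₂T c.1 c.2 hc₁ hc₂ hG.1 hG.2.1 hG.2.2
  -- monotone normalisation on admissible observables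
  have hle₁ : ∀ ⦃G : (V → S) → ℝ⦄ ⦃M : ℝ⦄, Adm G → (∀ σ, G σ ≤ M) → E₁ G ≤ M :=
    fun G M hG hM => h₁le hG.1 hG.2.1 hG.2.2 hM
  have hge₁ : ∀ ⦃G : (V → S) → ℝ⦄ ⦃M : ℝ⦄, Adm G → (∀ σ, M ≤ G σ) → M ≤ E₁ G :=
    fun G M hG hM => h₁ge hG.1 hG.2.1 hG.2.2 hM
  have hle₂ : ∀ ⦃G : (V → S) → ℝ⦄ ⦃M : ℝ⦄, Adm G → (∀ σ, G σ ≤ M) → E₂ G ≤ M :=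
    fun G M hG hM => h₂le hG.1 hG.2.1 hG.2.2 hM
  have hge₂ : ∀ ⦃G : (V → S) → ℝ⦄ ⦃M : ℝ⦄, Adm G → (∀ σ, M ≤ G σ) → M ≤ E₂ G :=
    fun G M hG hM => h₂ge hG.1 hG.2.1 hG.2.2 hM
  -- profile hypotheses on `↥Λ`
  have hUι : ∀ x : ↥Λ, ℓ x.1 ≠ 0 → ∀ c : ↥Λ, x ∈ win' c → c ∈ U := by
    intro x hx c hxc
    refine Finset.mem_filter.2 ⟨Finset.mem_univ _, ?_⟩
    by_cases hc : nbhd c.1 ⊆ Λ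
    · exact ⟨hc, (hU x.1 hx c.1 ((mem_win'_gen hc).1 hxc)).2.2⟩
    · rw [(mem_win'_frz hc).1 hxc] at hx
      exact absurd (hU c.1 hx c.1 (hself c.1)).2.1 hc
  have hℓι : ∀ c x y : ↥Λ, x ∈ win' c → k' c y x ≠ 0 → ℓ x.1 ≤ ℓ y.1 + 1 := by
    intro c x y hxc hkc
    by_cases hc : nbhd c.1 ⊆ Λ
    · simp only [hk', if_pos hc] at hkc
      exact hℓ c.1 x.1 y.1 ((mem_win'_gen hc).1 hxc) hkc
    · simp only [hk', if_neg hc, ne_eq, not_true_eq_false] at hkc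
  -- (hsum) received sums on `↥Λ`: genuine windows contribute `≤ γ₀`, frozen centres contribute `0`
  have hsumι : ∀ x : ↥Λ, ∑ c ∈ Finset.univ.filter (fun c => x ∈ win' c), ∑ y, k' c y x ≤
      γ₀ * (Finset.univ.filter fun c => x ∈ win' c).card := by
    intro x
    have hterm : ∀ c ∈ Finset.univ.filter (fun c => x ∈ win' c), ∑ y, k' c y x ≤ γ₀ := by
      intro c hc
      have hxc := (Finset.mem_filter.1 hc).2
      by_cases hgen : nbhd c.1 ⊆ Λ
      · simp only [hk', if_pos hgen]
        have h1 : ∑ y : ↥Λ, K c.1 y.1 x.1 = ∑ y ∈ Λ, K c.1 y x.1 :=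
          Finset.sum_coe_sort Λ (fun y => K c.1 y x.1)
        have h2 : ∑ y ∈ Λ, K c.1 y x.1 = ∑ y ∈ nbhd c.1, K c.1 y x.1 := by
          refine (Finset.sum_subset hgen fun y _ hy => ?_).symm
          by_contra h
          exact hy (hKsupp _ _ _ h)
        rw [h1, h2]
        exact hsum c.1 x.1 ((mem_win'_gen hgen).1 hxc)
      · simp only [hk', if_neg hgen, Finset.sum_const_zero]
        exact hγ₀
    calc ∑ c ∈ Finset.univ.filter (fun c => x ∈ win' c), ∑ y, k' c y x
        ≤ ∑ _c ∈ Finset.univ.filter (fun c => x ∈ win' c), γ₀ := Finset.sum_le_sum hterm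
      _ = γ₀ * (Finset.univ.filter fun c => x ∈ win' c).card := by
          rw [Finset.sum_const, nsmul_eq_mul, mul_comm]
  -- (hN) at most `N⋆` windows of `↥Λ` around a site
  have hNι : ∀ x : ↥Λ, (Finset.univ.filter fun c => x ∈ win' c).card ≤ Nstar := by
    intro x
    refine le_trans ?_ (hN x.1 Λ)
    refine Finset.card_le_card_of_injOn (fun c : ↥Λ => c.1) (fun c hc => ?_) ?_
    · exact Finset.mem_filter.2 ⟨c.2, mem_win_of_mem_win' (Finset.mem_filter.1 hc).2⟩
    · intro a _ b _ h
      exact Subtype.ext h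
  have hselfι : ∀ x : ↥Λ, x ∈ win' x := fun x => by
    by_cases hc : nbhd x.1 ⊆ Λ
    · exact (mem_win'_gen hc).2 (hself x.1)
    · exact (mem_win'_frz hc).2 rfl
  -- the data of `F`
  have hFA : Adm F := ⟨hFm, ⟨B, hB⟩, hFdep⟩
  have hδι : Lip F fun x : ↥Λ => δ x.1 :=
    ⟨fun x => hδ.nonneg x.1, fun x σ τ hστ => hδ.le x.1 σ τ hστ⟩
  have hδ0ι : ∀ x : ↥Λ, ℓ x.1 < L₀ → (fun x : ↥Λ => δ x.1) x = 0 := fun x hx => hδL x.1 hx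
  -- the finite-cell window comparison theorem
  have key := abs_sub_le_exp (ι := ↥Λ) (Ω := V → S) (Adm := Adm) (Lip := Lip) (T := T)
    (win := win') (k := k') (U := U) (E₁ := E₁) (E₂ := E₂) hR hlip0 hoscA hk hTA hdust hle₁ hge₁
    hinv₁ hle₂ hge₂ hinv₂ hγ₀ hγ₁
    (Nstar := Nstar) (fun x : ↥Λ => ℓ x.1) hUι hℓι hsumι hNι hselfι L₀ hFA hδι hδ0ι
  have hs : ∑ x : ↥Λ, δ x.1 = ∑ x ∈ Λ, δ x := Finset.sum_coe_sort Λ δ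
  rw [hs] at key
  exact key


/-! ### Covariance decay of every Gibbs measure, arbitrary index set -/

/-- **Covariance decay under the Dobrushin–Shlosman window condition, for every Gibbs measure of a
specification on an ARBITRARY index set** (Föllmer 1988 Ch. I Thm. (2.13) / Künsch 1982 / Georgii 2011 §8.2
tilt trick on top of `abs_sub_le_of_window`): window data as there; `μ` a Gibbs measure; `f, g` bounded
measurable reading the finite sets `Δf, Δg` with site-Lipschitz vectors `δf, δg`; a finite volume `Λ ⊇ Δf, Δg`
and a profile `ℓ` such that every window around a site of positive profile has its centre and locality set
inside `Λ` and avoids `Δg`, `ℓ` drops by at most one along the support of `K`, and `ℓ ≥ L₀` on `Δf`. Then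
`|cov_μ(f, g)| ≤ 4 R² e^{−(1−γ₀)² L₀/(2(2γ₀N⋆+1))} (Σ_{Δf} δf)(Σ_{Δg} δg)`.
[cite: Follmer1988, Ch. I Theorem (2.13)] -/
theorem abs_covariance_le_of_window [DecidableEq V] {γ : Specification V S} (hγ : IsSpecification γ)
    {r : S → S → ℝ} {R : ℝ} (hr0 : ∀ a b, 0 ≤ r a b) (hrR : ∀ a b, r a b ≤ R) (hR : 0 ≤ R)
    {win nbhd : V → Finset V} {K : V → V → V → ℝ} (hK0 : ∀ c y x, 0 ≤ K c y x)
    (hself : ∀ c, c ∈ win c) (hwin : ∀ c, win c ⊆ nbhd c)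
    (hKsupp : ∀ c y x, K c y x ≠ 0 → y ∈ nbhd c)
    (hcontract : ∀ (c y : V), y ∉ win c → ∀ (ω η : V → S), (∀ v, v ≠ y → ω v = η v) →
      ∀ (f : (V → S) → ℝ) (δ : V → ℝ), Measurable f → (∃ B, ∀ σ, |f σ| ≤ B) →
        DependsOn f (win c : Set V) → (∀ x, 0 ≤ δ x) →
        (∀ (x : V) (σ τ : V → S), (∀ v, v ≠ x → σ v = τ v) → |f σ - f τ| ≤ δ x * r (σ x) (τ x)) →
          |∫ σ, f σ ∂(γ (win c) ω) - ∫ σ, f σ ∂(γ (win c) η)| ≤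
            (∑ x ∈ win c, K c y x * δ x) * r (ω y) (η y))
    (hloc : ∀ (c : V) (ζ ζ' : V → S), (∀ v ∈ nbhd c, ζ v = ζ' v) →
      ∀ (f : (V → S) → ℝ), Measurable f → (∃ B, ∀ σ, |f σ| ≤ B) → DependsOn f (win c : Set V) →
        ∫ σ, f σ ∂(γ (win c) ζ) = ∫ σ, f σ ∂(γ (win c) ζ'))
    {γ₀ : ℝ} (hγ₀ : 0 ≤ γ₀) (hγ₁ : γ₀ < 1)
    (hsum : ∀ c, ∀ x ∈ win c, ∑ y ∈ nbhd c, K c y x ≤ γ₀)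
    {Nstar : ℕ} (hN : ∀ (x : V) (G : Finset V), (G.filter fun c => x ∈ win c).card ≤ Nstar)
    {μ : Measure (V → S)} (hμ : IsGibbsMeasure γ μ) {f g : (V → S) → ℝ} (hfm : Measurable f)
    (hgm : Measurable g) {Bf Bg : ℝ} (hBf : ∀ σ, |f σ| ≤ Bf) (hBg : ∀ σ, |g σ| ≤ Bg)
    {Δf Δg : Finset V} (hfdep : DependsOn f (Δf : Set V)) (hgdep : DependsOn g (Δg : Set V))
    {δf δg : V → ℝ} (hδf : IsLipBound r f δf) (hδg : IsLipBound r g δg)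
    (Λ : Finset V) (hΔf : Δf ⊆ Λ) (ℓ : V → ℕ) (L₀ : ℕ)
    (hU : ∀ x, ℓ x ≠ 0 → ∀ c, x ∈ win c → c ∈ Λ ∧ nbhd c ⊆ Λ ∧ ∀ z ∈ win c, z ∉ Δg)
    (hℓ : ∀ c x y, x ∈ win c → K c y x ≠ 0 → ℓ x ≤ ℓ y + 1) (hL : ∀ x ∈ Δf, L₀ ≤ ℓ x) :
    |cov[f, g; μ]| ≤ 4 * R ^ 2 * Real.exp (-((1 - γ₀) ^ 2 / (2 * (2 * γ₀ * Nstar + 1)) * L₀)) *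
      (∑ x ∈ Δf, δf x) * ∑ y ∈ Δg, δg y := by
  -- adapted from `DobrushinShlosman.abs_covariance_le` (finite cell type)
  classical
  haveI := hμ.isProbabilityMeasure
  obtain ⟨τ₀, -⟩ := nonempty_of_measure_ne_zero (μ := μ) (s := Set.univ) (by simp)
  set κ₁ : ℝ := (1 - γ₀) ^ 2 / (2 * (2 * γ₀ * Nstar + 1)) with hκ₁
  -- the shifted density `g̃ ∈ [0, 2 S_g]`
  set Sg : ℝ := R * ∑ y ∈ Δg, δg y with hSg
  have hSg0 : 0 ≤ Sg := mul_nonneg hR (Finset.sum_nonneg fun y _ => hδg.nonneg y)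
  have hosc : ∀ σ, |g σ - g τ₀| ≤ Sg := fun σ => abs_sub_le_mul_sum_of_dependsOn hrR hgdep hδg σ τ₀
  set gt : (V → S) → ℝ := fun σ => g σ + (Sg - g τ₀) with hgt
  have hgt0 : ∀ σ, 0 ≤ gt σ := fun σ => by
    have := (abs_le.1 (hosc σ)).1; simp only [hgt]; linarith
  have hgtB : ∀ σ, gt σ ≤ 2 * Sg := fun σ => by
    have := (abs_le.1 (hosc σ)).2; simp only [hgt]; linarith
  have hgtm : Measurable gt := hgm.add_const _
  have hgtdep : DependsOn gt (Δg : Set V) := fun σ τ h => by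
    simp only [hgt]; rw [hgdep h]
  have hgi : Integrable g μ := integrable_of_abs_le' hgm hBg
  have hfi : Integrable f μ := integrable_of_abs_le' hfm hBf
  have hgtabs : ∀ σ, |gt σ| ≤ 2 * Sg := fun σ => by
    rw [abs_of_nonneg (hgt0 σ)]; exact hgtB σ
  have hgti : Integrable gt μ := integrable_of_abs_le' hgtm hgtabs
  -- the right-hand side is nonnegative
  have hRHS : 0 ≤ 4 * R ^ 2 * Real.exp (-(κ₁ * L₀)) * (∑ x ∈ Δf, δf x) * ∑ y ∈ Δg, δg y := by
    have := Finset.sum_nonneg fun x (_ : x ∈ Δf) => hδf.nonneg x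
    have := Finset.sum_nonneg fun y (_ : y ∈ Δg) => hδg.nonneg y
    positivity
  -- `cov(f, g) = cov(f, g̃) = μ(f g̃) - μ(f) μ(g̃)`
  have hcov : cov[f, g; μ] = ∫ σ, f σ * gt σ ∂μ - (∫ σ, f σ ∂μ) * ∫ σ, gt σ ∂μ := by
    have h1 : cov[f, g; μ] = cov[f, gt; μ] := by
      rw [hgt, covariance_add_const_right hgi]
    rw [h1, covariance_eq_sub]
    · rfl
    · exact memLp_of_bounded (a := -Bf) (b := Bf)
        (ae_of_all _ fun σ => abs_le.1 (hBf σ)) hfm.aestronglyMeasurable 2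
    · exact memLp_of_bounded (a := -(2 * Sg)) (b := 2 * Sg)
        (ae_of_all _ fun σ => abs_le.1 (hgtabs σ)) hgtm.aestronglyMeasurable 2
  by_cases hz : ∫ σ, gt σ ∂μ = 0
  · -- degenerate case: `g̃ = 0` a.e., so the covariance vanishes
    have hae : gt =ᵐ[μ] 0 := (integral_eq_zero_iff_of_nonneg (fun σ => hgt0 σ) hgti).1 hz
    have hfg : ∫ σ, f σ * gt σ ∂μ = 0 := by
      rw [← integral_zero (α := V → S) (μ := μ) (G := ℝ)]
      refine integral_congr_ae ?_
      filter_upwards [hae] with σ hσ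
      simp [hσ]
    rw [hcov, hfg, hz, mul_zero, sub_zero, abs_zero]
    exact hRHS
  have hpos : 0 < ∫ σ, gt σ ∂μ := lt_of_le_of_ne (integral_nonneg hgt0) (Ne.symm hz)
  -- the two functionals: `μ` and its tilt by `g̃`; usable = windows inside `Λ` avoiding `Δg`
  have hgfi : ∀ {F : (V → S) → ℝ}, Measurable F → ∀ {B : ℝ}, (∀ σ, |F σ| ≤ B) →
      Integrable (fun σ => gt σ * F σ) μ := fun hFm B hB =>
    hgti.mul_bdd hFm.aestronglyMeasurable (ae_of_all _ fun σ => by rw [Real.norm_eq_abs]; exact hB σ)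
  have h₁le : ∀ ⦃F : (V → S) → ℝ⦄ ⦃M : ℝ⦄, Measurable F → (∃ B, ∀ σ, |F σ| ≤ B) →
      DependsOn F (Λ : Set V) → (∀ σ, F σ ≤ M) → ∫ σ, F σ ∂μ ≤ M := by
    rintro F M hFm ⟨B, hB⟩ - hM
    calc ∫ σ, F σ ∂μ ≤ ∫ _σ, M ∂μ := integral_mono (integrable_of_abs_le' hFm hB) (integrable_const M) hM
      _ = M := by simp
  have h₁ge : ∀ ⦃F : (V → S) → ℝ⦄ ⦃M : ℝ⦄, Measurable F → (∃ B, ∀ σ, |F σ| ≤ B) →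
      DependsOn F (Λ : Set V) → (∀ σ, M ≤ F σ) → M ≤ ∫ σ, F σ ∂μ := by
    rintro F M hFm ⟨B, hB⟩ - hM
    calc M = ∫ _σ, M ∂μ := by simp
      _ ≤ ∫ σ, F σ ∂μ := integral_mono (integrable_const M) (integrable_of_abs_le' hFm hB) hM
  have h₁T : ∀ c, c ∈ Λ → nbhd c ⊆ Λ → (∀ z ∈ win c, z ∉ Δg) → ∀ ⦃F : (V → S) → ℝ⦄, Measurable F →
      (∃ B, ∀ σ, |F σ| ≤ B) → DependsOn F (Λ : Set V) →
        ∫ σ, (fun σ => ∫ τ, F τ ∂(γ (win c) σ)) σ ∂μ = ∫ σ, F σ ∂μ := by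
    rintro c - - - F hFm ⟨B, hB⟩ -
    exact hμ.integral_integral_eq hγ (win c) (integrable_of_abs_le' hFm hB)
  have h₂le : ∀ ⦃F : (V → S) → ℝ⦄ ⦃M : ℝ⦄, Measurable F → (∃ B, ∀ σ, |F σ| ≤ B) →
      DependsOn F (Λ : Set V) → (∀ σ, F σ ≤ M) → (∫ σ, gt σ * F σ ∂μ) / ∫ σ, gt σ ∂μ ≤ M := by
    rintro F M hFm ⟨B, hB⟩ - hM
    rw [div_le_iff₀ hpos]
    calc ∫ σ, gt σ * F σ ∂μ ≤ ∫ σ, gt σ * M ∂μ :=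
          integral_mono (hgfi hFm hB) (hgti.mul_const M) fun σ => mul_le_mul_of_nonneg_left (hM σ) (hgt0 σ)
      _ = M * ∫ σ, gt σ ∂μ := by rw [integral_mul_const, mul_comm]
  have h₂ge : ∀ ⦃F : (V → S) → ℝ⦄ ⦃M : ℝ⦄, Measurable F → (∃ B, ∀ σ, |F σ| ≤ B) →
      DependsOn F (Λ : Set V) → (∀ σ, M ≤ F σ) → M ≤ (∫ σ, gt σ * F σ ∂μ) / ∫ σ, gt σ ∂μ := by
    rintro F M hFm ⟨B, hB⟩ - hM
    rw [le_div_iff₀ hpos]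
    calc M * ∫ σ, gt σ ∂μ = ∫ σ, gt σ * M ∂μ := by rw [integral_mul_const, mul_comm]
      _ ≤ ∫ σ, gt σ * F σ ∂μ :=
          integral_mono (hgti.mul_const M) (hgfi hFm hB) fun σ => mul_le_mul_of_nonneg_left (hM σ) (hgt0 σ)
  have h₂T : ∀ c, c ∈ Λ → nbhd c ⊆ Λ → (∀ z ∈ win c, z ∉ Δg) → ∀ ⦃F : (V → S) → ℝ⦄, Measurable F →
      (∃ B, ∀ σ, |F σ| ≤ B) → DependsOn F (Λ : Set V) →
        (∫ σ, gt σ * (fun σ => ∫ τ, F τ ∂(γ (win c) σ)) σ ∂μ) / ∫ σ, gt σ ∂μ =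
          (∫ σ, gt σ * F σ ∂μ) / ∫ σ, gt σ ∂μ := by
    rintro c - - hc F hFm ⟨B, hB⟩ -
    congr 1
    have hmul : ∀ η, gt η * (∫ τ, F τ ∂(γ (win c) η)) = ∫ τ, gt τ * F τ ∂(γ (win c) η) := fun η =>
      mul_windowAvg_eq_of_dependsOn hγ (cell := id) (Λ := win c) (W := win c) (fun v => Iff.rfl)
        (g := gt) (Δg := Δg) hgtdep hc F η
    simp_rw [hmul]
    exact hμ.integral_integral_eq hγ (win c) (hgfi hFm hB)
  -- the comparison theorem for `f` with its Lipschitz vector cut down to `Δf`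
  have hfdepΛ : DependsOn f (Λ : Set V) :=
    hfdep.mono fun v hv => Finset.mem_coe.2 (hΔf (Finset.mem_coe.1 hv))
  have hδL : ∀ x, ℓ x < L₀ → (fun x => if x ∈ Δf then δf x else 0) x = 0 := fun x hx => by
    dsimp only
    split_ifs with hxΔ
    · exact absurd (hL x hxΔ) (not_le.2 hx)
    · rfl
  have key := abs_sub_le_of_window hγ hr0 hrR hR hK0 hself hwin hKsupp hcontract hloc hγ₀ hγ₁ hsum hN
    Λ τ₀ (fun c => ∀ z ∈ win c, z ∉ Δg) (E₁ := fun F => ∫ σ, F σ ∂μ)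
    (E₂ := fun F => (∫ σ, gt σ * F σ ∂μ) / ∫ σ, gt σ ∂μ) h₁le h₁ge h₁T h₂le h₂ge h₂T ℓ L₀ hU hℓ
    hfm hBf hfdepΛ (hδf.restrict hfdep) hδL
  have hs : ∑ x ∈ Λ, (if x ∈ Δf then δf x else 0) = ∑ x ∈ Δf, δf x := by
    rw [Finset.sum_ite_mem, Finset.inter_eq_right.2 hΔf]
  rw [hs] at key
  change |∫ σ, f σ ∂μ - (∫ σ, gt σ * f σ ∂μ) / ∫ σ, gt σ ∂μ| ≤
    2 * R * Real.exp (-(κ₁ * L₀)) * ∑ x ∈ Δf, δf x at key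
  -- `cov = μ(g̃) · (μ_{g̃}(f) - μ(f))`
  have hfgt : ∫ σ, f σ * gt σ ∂μ = ∫ σ, gt σ * f σ ∂μ :=
    integral_congr_ae (ae_of_all _ fun σ => mul_comm _ _)
  have hident : cov[f, g; μ] =
      (∫ σ, gt σ ∂μ) * ((∫ σ, gt σ * f σ ∂μ) / ∫ σ, gt σ ∂μ - ∫ σ, f σ ∂μ) := by
    rw [hcov, hfgt, mul_sub, mul_div_cancel₀ _ hz]
    ring
  rw [hident, abs_mul, abs_of_pos hpos, abs_sub_comm]
  have hgtint : ∫ σ, gt σ ∂μ ≤ 2 * Sg := by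
    calc ∫ σ, gt σ ∂μ ≤ ∫ _σ, 2 * Sg ∂μ := integral_mono hgti (integrable_const _) hgtB
      _ = 2 * Sg := by simp
  have hexp : 0 ≤ 2 * R * Real.exp (-(κ₁ * L₀)) * ∑ x ∈ Δf, δf x := by
    have := Finset.sum_nonneg fun x (_ : x ∈ Δf) => hδf.nonneg x
    positivity
  calc (∫ σ, gt σ ∂μ) * |∫ σ, f σ ∂μ - (∫ σ, gt σ * f σ ∂μ) / ∫ σ, gt σ ∂μ|
      ≤ (2 * Sg) * (2 * R * Real.exp (-(κ₁ * L₀)) * ∑ x ∈ Δf, δf x) :=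
        mul_le_mul hgtint key (abs_nonneg _) (by positivity)
    _ = 4 * R ^ 2 * Real.exp (-(κ₁ * L₀)) * (∑ x ∈ Δf, δf x) * ∑ y ∈ Δg, δg y := by
        rw [hSg]; ring

end Literature.Probability.LatticeModels.DobrushinShlosman

end
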